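import Literature.AlgebraicGeometry.HodgeTheory.GeneralHodgePropertyTwistedDescent
import HarnessLib

/-!
# Functoriality of Grothendieck's largest rational sub-Hodge structure contained in `Fᶜ Hⁱ`
# under `g^*`, `Lʳ_η` and the Gysin morphism `g_*`; equalities along a surjection

Family `hodge`, layer `Literature/AlgebraicGeometry/HodgeTheory`; lane `lit-hodgefound` (Track 2 foundations,
Layer A1). THEOREMS ONLY (no definition, no named fact; D-0026).

Grothendieck (Topology 8, 1969, p. 300) corrects Hodge's general conjecture by replacing
`Fᶜ Hⁱ(X^an, ℂ) ∩ Hⁱ(X^an, ℚ)` with «the largest sub-space of [it], generating a subspace of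
`Hⁱ(X^an, ℂ)` which is a sub-Hodge structure, i.e. stable under decomposition into `p, q` types». On the
tree's carriers this is `HodgeModel.maxRatSubHodgeInFilt A i c` (`HodgeTheory/IntermediateJacobian`):
the supremum of the ADMISSIBLE subspaces `A.ratSubHodgeInFilt i c` of `Hⁱ(X(ℂ); ℂ)` — rationally spanned,
a sub-Hodge structure after pull-back to the Hodge model `A`, contained in `Fᶜ` — itself admissible
(`maxRatSubHodgeInFilt_mem`); `GHC(X, i, c)` (`GeneralHodgePropertyFor`) says `max ≤ Nᶜ Hⁱ(X(ℂ); ℂ)`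
(`generalHodgePropertyFor_iff_maxRatSubHodgeInFilt_le`). Voisin I §7.3.1 (7.5): the image of a morphism of
Hodge structures is a sub-Hodge structure; §7.3.2: «`φ^*` is a morphism of Hodge structures», «`φ_*` is a
morphism of Hodge structures of bidegree `(r, r)`» (with Lemma 7.30; Voisin 2025 §2.3: «the Gysin morphism
`φ_* : Hᵏ(X, ℚ) → H^{k−2d}(Y, ℚ)`, `d := dim X − dim Y`, is a morphism of Hodge structures»), and the
Lefschetz operator has bidegree `(1, 1)` (§6.2.3 Rem. 6.27). This file records the resulting functoriality
of the admissible sets and of their suprema, for a morphism `g : X ⟶ W` of smooth projective complex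
varieties with `dim X = dim W + r`:

* §1 MODEL INDEPENDENCE (the tree's theorem `hodgePQ_independent_of_hodgeModel_holds`):
  `HodgeModel.hodgeFiltrationBetti_eq_of_hodgeModel`, `HodgeModel.ratSubHodgeInFilt_eq_of_hodgeModel`,
  **`HodgeModel.maxRatSubHodgeInFilt_eq_of_hodgeModel`**, and `generalHodgePropertyFor_iff_of_hodgeModel`
  (`GHC(X, i, c)` may be tested in ONE Hodge model).
* §2 THE GYSIN MORPHISM `g_* = complexGysin complexOrientationFamily … : Hᵃ(X(ℂ); ℂ) → Hᵇ(W(ℂ); ℂ)`,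
  `a = b + 2r`, PRESERVES ADMISSIBILITY WITH THE SHIFT `(a, c + r) ↦ (b, c)`: `IsRationallySpanned.map_complexGysin`
  (any degrees), `isOfHodgeType_complexGysin_of_add_eq` (type `(p' + r, q' + r) ↦ (p', q')`),
  `complexGysin_eq_zero_of_isOfHodgeType_of_lt` (types with `p < r` or `q < r` are killed),
  **`HodgeModel.IsSubHodge.map_complexGysin`**, `HodgeModel.map_complexGysin_hodgeFiltrationBetti_le`
  (`g_* F^{c+r} Hᵃ(X) ⊆ Fᶜ Hᵇ(W)`), **`HodgeModel.complexGysin_map_mem_ratSubHodgeInFilt`**.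
* §3 THE LARGEST ADMISSIBLE SUBSPACES (any `g`): `g^*(max_W(i, c)) ≤ max_X(i, c)`
  (`HodgeModel.map_complexBetti_map_maxRatSubHodgeInFilt_le`, from the tree's `HodgeModel.map_mem_ratSubHodgeInFilt`),
  `Lʳ_η(max_X(i, c)) ≤ max_X(i + 2r, c + r)` (`KaehlerRationalDatum.map_lefschetzPow_maxRatSubHodgeInFilt_le`),
  **`g_*(max_X(a, c + r)) ≤ max_W(b, c)`** (`HodgeModel.map_complexGysin_maxRatSubHodgeInFilt_le`) and
  `(g_* ∘ Lʳ_η)(max_X(i, c)) ≤ max_W(i, c)`.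
* §4 ALONG A SURJECTION `g : X ↠ W` (`g_*(Lʳ_η(g^* x)) = c₀ • x`, `c₀ ≠ 0`: Voisin I Lemma 7.28 with the
  wedge kept, the tree's `SurjectivePushPullSplitting`) the inequalities are EQUALITIES:
  **`HodgeModel.map_complexGysin_lefschetzPow_maxRatSubHodgeInFilt_eq`** (`(g_* ∘ Lʳ_η)(max_X(i, c)) = max_W(i, c)`),
  **`HodgeModel.map_complexGysin_maxRatSubHodgeInFilt_eq`** (`g_*(max_X(i + 2r, c + r)) = max_W(i, c)`: the
  largest rational sub-Hodge structure in `Fᶜ Hⁱ(W)` is the Gysin image of the one in `F^{c+r} H^{i+2r}(X)`),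
  **`HodgeModel.comap_complexBetti_map_maxRatSubHodgeInFilt_eq`** (`(g^*)⁻¹(max_X(i, c)) = max_W(i, c)`),
  `HodgeModel.map_complexGysin_algebraicPart_eq` (the algebraic parts `HodgeModel.algebraicPart` attached to
  the intermediate Jacobians, Voisin II §8.2.1) and `generalHodgePropertyFor_iff_map_complexGysin_le_of_surjective`
  (`GHC(W, i, c) ↔ g_*(max_X(i + 2r, c + r)) ≤ Nᶜ Hⁱ(W)`).

## References

* [GrothendieckTopology1969] A. Grothendieck, Hodge's general conjecture is false for trivial reasons,
  Topology 8 (1969), p. 300 (the amended statement; footnote: «As the previous homomorphisms are compatible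
  with the Hodge structures, the assertion follows»).
* [VoisinHodgeI2002] C. Voisin, Hodge Theory and Complex Algebraic Geometry I, CUP 2002, §6.2.3 Rem. 6.27,
  §7.1.1, §7.3.1 (7.5), §7.3.2 with Lemma 7.28, Remark 7.29 and Lemma 7.30, §11.3 Conj. 11.37, §12.2.2.
* [Voisin2025] C. Voisin, Hodge and generalized Hodge conjectures, coniveau and algebraic cycles, J. Open
  Math. Probl. 1 (2025), §2.3 (covariant functoriality: the Gysin morphism is a morphism of Hodge structures),
  Def. 2.8, §4.1 («`L^{p',q'} = 0` if `p' < c` or `q' < c`»).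
* [VoisinHodgeII2003] C. Voisin, Hodge Theory and Complex Algebraic Geometry II, CUP 2003, §8.2.1 (before
  Thm. 8.15: the largest Hodge substructure contained in `F^{k-1} H^{2k-1}`), §9.2.4 Prop. 9.21 (ii).
* [Arapura2006] D. Arapura, Motivation for Hodge cycles, Adv. Math. 207 (2006), §4 Lemma 4.2 (inheritance
  of `GHC` under domination, via motivated motives).
-/

noncomputable section

open CategoryTheory AlgebraicGeometry
open Literature.AlgebraicTopology.SingularHomology
open Literature.Geometry.Kaehler
open Literature.AlgebraicGeometry.Motives (IsSmoothProjective ComplexPoints)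

namespace Literature.AlgebraicGeometry.HodgeTheory

variable {n m : ℕ} {X W : Motives.SchemeOver ℂ}

/-! ### §1 The admissible set and its supremum do not depend on the Hodge model -/

/-- **`Fʳ Hᵏ(X(ℂ); ℂ)` does not depend on the Hodge model** (the tree's theorem
`hodgePQ_independent_of_hodgeModel_holds`, read on the filtration: `…mem_hodgeFiltration_iff`).
[cite: VoisinHodgeI2002, §7.1.1 and §7.3.2] -/
theorem HodgeModel.hodgeFiltrationBetti_eq_of_hodgeModel (A A' : HodgeModel n X)
    (hX : IsSmoothProjective n X) (k r : ℕ) :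
    A.hodgeFiltrationBetti k r = A'.hodgeFiltrationBetti k r := by
  ext c
  exact hodgePQ_independent_of_hodgeModel_holds.mem_hodgeFiltration_iff hX A A'

/-- **The admissible subspaces (rationally spanned, sub-Hodge after pull-back, inside `Fʳ`) are the
same for all Hodge models** of a smooth projective `X` (`HodgeModel.IsSubHodge.of_hodgeModel` and
`hodgeFiltrationBetti_eq_of_hodgeModel`). [cite: VoisinHodgeI2002, §7.3.1 and Prop. 6.11]
[cite: VoisinHodgeII2003, §8.2.1 (before Thm. 8.15)] -/
theorem HodgeModel.ratSubHodgeInFilt_eq_of_hodgeModel (A A' : HodgeModel n X)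
    (hX : IsSmoothProjective n X) (k r : ℕ) :
    A.ratSubHodgeInFilt k r = A'.ratSubHodgeInFilt k r := by
  ext W'
  exact and_congr_right' (and_congr
    ⟨HodgeModel.IsSubHodge.of_hodgeModel hodgePQ_independent_of_hodgeModel_holds hX A A',
      HodgeModel.IsSubHodge.of_hodgeModel hodgePQ_independent_of_hodgeModel_holds hX A' A⟩
    (by rw [A.hodgeFiltrationBetti_eq_of_hodgeModel A' hX k r]))

/-- **Grothendieck's largest rational sub-Hodge structure contained in `Fʳ Hᵏ(X(ℂ); ℂ)` does not
depend on the Hodge model used to read the Hodge decomposition.**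
[cite: GrothendieckTopology1969, p. 300] [cite: VoisinHodgeI2002, Prop. 6.11 and §7.3.1] -/
theorem HodgeModel.maxRatSubHodgeInFilt_eq_of_hodgeModel (A A' : HodgeModel n X)
    (hX : IsSmoothProjective n X) (k r : ℕ) :
    A.maxRatSubHodgeInFilt k r = A'.maxRatSubHodgeInFilt k r := by
  rw [HodgeModel.maxRatSubHodgeInFilt, HodgeModel.maxRatSubHodgeInFilt,
    A.ratSubHodgeInFilt_eq_of_hodgeModel A' hX k r]

/-- **`GHC(X, i, r)` may be tested in ONE Hodge model**: for a smooth projective `X` with a Hodge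
model `A`, `GeneralHodgePropertyFor n X i r ↔ A.maxRatSubHodgeInFilt i r ≤ Nʳ Hⁱ(X(ℂ); ℂ)`
(Grothendieck's phrasing `generalHodgePropertyFor_iff_maxRatSubHodgeInFilt_le`, with §1's model
independence). [cite: GrothendieckTopology1969, p. 300] [cite: VoisinHodgeI2002, §11.3 Conj. 11.37] -/
theorem generalHodgePropertyFor_iff_of_hodgeModel (A : HodgeModel n X) (hX : IsSmoothProjective n X)
    (i r : ℕ) :
    GeneralHodgePropertyFor n X i r ↔ A.maxRatSubHodgeInFilt i r ≤ supportedClasses X i r := by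
  rw [generalHodgePropertyFor_iff_maxRatSubHodgeInFilt_le]
  exact ⟨fun h ↦ h.2 A,
    fun h ↦ ⟨⟨A⟩, fun A' ↦ by rwa [A'.maxRatSubHodgeInFilt_eq_of_hodgeModel A hX i r]⟩⟩

/-! ### §2 The Gysin morphism preserves the admissibility conditions, bidegree `(-r, -r)` -/

/-- **The Gysin morphism of the complex orientations maps rationally spanned subspaces to rationally
spanned subspaces** (it preserves rational classes: `isRationalClass_complexGysin_complexOrientationFamily`);
any morphism `g : X ⟶ W` of smooth projective complex varieties, any degrees `a + 2 dim W = b + 2 dim X`.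
[cite: VoisinHodgeI2002, §7.3.2] [cite: Voisin2025, §2.3] -/
theorem IsRationallySpanned.map_complexGysin (hX : IsSmoothProjective n X) (hW : IsSmoothProjective m W)
    (g : X ⟶ W) {a b : ℕ} (hab : a + 2 * m = b + 2 * n) {W' : Submodule ℂ (complexBetti X a)}
    (hW' : IsRationallySpanned W') :
    IsRationallySpanned (W'.map (complexGysin complexOrientationFamily hX hW g hab)) := by
  refine (isRationallySpanned_iff_le _).2 ?_
  conv_lhs => rw [hW']
  rw [Submodule.map_span]
  refine Submodule.span_mono ?_
  rintro _ ⟨c, ⟨hc, hcQ⟩, rfl⟩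
  exact ⟨Submodule.mem_map_of_mem hc,
    isRationalClass_complexGysin_complexOrientationFamily hX hW g hab hcQ⟩

/-- **`g_*` has bidegree `(-r, -r)`**: for `g : X ⟶ W` of smooth projective complex varieties with
`dim X = dim W + r`, a class of type `(p' + r, q' + r)` on `X` is sent to a class of type `(p', q')` on
`W` (Voisin I §7.3.2 with Lemma 7.30 — the tree's `isOfHodgeType_complexGysin_of_cupPreservesHodgeType`,
fed with Hodge models of `X` and `W` (`nonempty_hodgeModel_holds`), `cupPreservesHodgeType_of_hodgeModel`
and `hodgePQ_independent_of_hodgeModel_holds`). [cite: VoisinHodgeI2002, §7.3.2 (with Lemma 7.30)]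
[cite: Voisin2025, §2.3 and Def. 2.8] -/
theorem isOfHodgeType_complexGysin_of_add_eq (hX : IsSmoothProjective n X) (hW : IsSmoothProjective m W)
    (g : X ⟶ W) {r : ℕ} (hr : m + r = n) {a b : ℕ} (hab : a + 2 * m = b + 2 * n) {p q p' q' : ℕ}
    (hp : p' + r = p) (hq : q' + r = q) {x : complexBetti X a} (hx : IsOfHodgeType n X a p q x) :
    IsOfHodgeType m W b p' q' (complexGysin complexOrientationFamily hX hW g hab x) := by
  obtain ⟨B⟩ := nonempty_hodgeModel_holds (n := n) (X := X) hX
  obtain ⟨A⟩ := nonempty_hodgeModel_holds (n := m) (X := W) hW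
  exact isOfHodgeType_complexGysin_of_cupPreservesHodgeType hodgePQ_independent_of_hodgeModel_holds
    complexOrientationFamily hX hW B A (cupPreservesHodgeType_of_hodgeModel hX B)
    (cupPreservesHodgeType_of_hodgeModel hW A) g hab (by omega) (by omega) hx

/-- **`g_*` kills the Hodge types it cannot shift**: for `g : X ⟶ W` with `dim X = dim W + r` and a
class `x` of type `(p, q)` on `X` with `p < r` or `q < r`, `g_* x = 0` (the tree's
`complexGysin_eq_zero_of_hodgeType_of_lt`, fed as above; Voisin 2025 §4.1: «`L^{p',q'} = 0` if `p' < c`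
or `q' < c`» for the dual statement). [cite: VoisinHodgeI2002, §7.3.2 (with Lemma 7.30)]
[cite: Voisin2025, §2.3 and §4.1] -/
theorem complexGysin_eq_zero_of_isOfHodgeType_of_lt (hX : IsSmoothProjective n X)
    (hW : IsSmoothProjective m W) (g : X ⟶ W) {r : ℕ} (hr : m + r = n) {a b : ℕ}
    (hab : a + 2 * m = b + 2 * n) {p q : ℕ} (hpq : p < r ∨ q < r) {x : complexBetti X a}
    (hx : IsOfHodgeType n X a p q x) :
    complexGysin complexOrientationFamily hX hW g hab x = 0 := by
  obtain ⟨B, hB⟩ := hx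
  obtain ⟨A⟩ := nonempty_hodgeModel_holds (n := m) (X := W) hW
  exact complexGysin_eq_zero_of_hodgeType_of_lt hodgePQ_independent_of_hodgeModel_holds
    complexOrientationFamily hX hW B A (cupPreservesHodgeType_of_hodgeModel hX B)
    (cupPreservesHodgeType_of_hodgeModel hW A) g hab (by omega) hB

/-- **`g_*` of a sub-Hodge structure is a sub-Hodge structure** (Voisin I (7.5): the image of a
morphism of Hodge structures is a sub-Hodge structure): for `g : X ⟶ W` with `dim X = dim W + r`,
Hodge models `B` of `X` and `A` of `W`, and `W' ⊆ Hᵃ(X(ℂ); ℂ)` whose pull-back to `B` is a sub-Hodge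
structure, the pull-back of `g_* W' ⊆ Hᵇ(W(ℂ); ℂ)` to `A` is a sub-Hodge structure — the piece of type
`(p, q)` goes to type `(p − r, q − r)` when `p, q ≥ r` and to `0` otherwise
(`HodgeModel.IsSubHodge.map_of_hodgePQ`). [cite: VoisinHodgeI2002, §7.3.1 (7.5) and §7.3.2]
[cite: Voisin2025, §2.3] -/
theorem HodgeModel.IsSubHodge.map_complexGysin (B : HodgeModel n X) (A : HodgeModel m W)
    (hX : IsSmoothProjective n X) (hW : IsSmoothProjective m W) (g : X ⟶ W) {r : ℕ} (hr : m + r = n)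
    {a b : ℕ} (hab : a + 2 * m = b + 2 * n) {W' : Submodule ℂ (complexBetti X a)}
    (hW' : B.IsSubHodge a (W'.map (B.pullback a).hom)) :
    A.IsSubHodge b
      ((W'.map (complexGysin complexOrientationFamily hX hW g hab)).map (A.pullback b).hom) := by
  refine hW'.map_of_hodgePQ B A _ fun p q hpq ↦ ?_
  by_cases h : r ≤ p ∧ r ≤ q
  · refine ⟨p - r, q - r, by omega, fun y hy ↦ (isOfHodgeType_iff_mem_hodgePQ hW A _).1 ?_⟩
    exact isOfHodgeType_complexGysin_of_add_eq hX hW g hr hab (by omega) (by omega)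
      ((isOfHodgeType_iff_mem_hodgePQ hX B y).2 hy)
  · refine ⟨0, b, by omega, fun y hy ↦ ?_⟩
    rw [complexGysin_eq_zero_of_isOfHodgeType_of_lt hX hW g hr hab (by omega)
      ((isOfHodgeType_iff_mem_hodgePQ hX B y).2 hy), map_zero]
    exact Submodule.zero_mem _

/-- **`g_* F^{c+r} Hᵃ(X) ⊆ Fᶜ Hᵇ(W)`** (`a = b + 2r`, `dim X = dim W + r`) for the Hodge filtrations
read on `H(−(ℂ); ℂ)` through Hodge models `B` of `X`, `A` of `W`: on `H^{p,q}(X)` with `p ≥ c + r`,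
`g_*` lands in `H^{p−r,q−r}(W) ⊆ Fᶜ` or vanishes (`q < r`). [cite: VoisinHodgeI2002, §7.3.2 and §7.1.1]
[cite: Voisin2025, §2.3 and Def. 2.8] -/
theorem HodgeModel.map_complexGysin_hodgeFiltrationBetti_le (B : HodgeModel n X) (A : HodgeModel m W)
    (hX : IsSmoothProjective n X) (hW : IsSmoothProjective m W) (g : X ⟶ W) {r : ℕ} (hr : m + r = n)
    {a b : ℕ} (hab : a + 2 * m = b + 2 * n) (c : ℕ) :
    (B.hodgeFiltrationBetti a (c + r)).map (complexGysin complexOrientationFamily hX hW g hab) ≤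
      A.hodgeFiltrationBetti b c := by
  rintro _ ⟨x, hx, rfl⟩
  rw [SetLike.mem_coe, HodgeModel.mem_hodgeFiltrationBetti] at hx
  let S : Submodule ℂ (singularCohomology ℂ ℂ B.carrier a) :=
    ((A.hodgeFiltrationBetti b c).comap (complexGysin complexOrientationFamily hX hW g hab)).map
      (B.pullback a).hom
  have hle : B.hodgeFiltration a (c + r) ≤ S := by
    refine iSup_le fun p ↦ iSup_le fun q ↦ iSup_le fun hpq ↦ iSup_le fun hcp ↦ fun z hz ↦ ?_
    obtain ⟨x₀, rfl⟩ := B.pullback_surjective a z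
    refine ⟨x₀, ?_, rfl⟩
    change complexGysin complexOrientationFamily hX hW g hab x₀ ∈ A.hodgeFiltrationBetti b c
    rw [HodgeModel.mem_hodgeFiltrationBetti]
    by_cases hq : r ≤ q
    · exact A.hodgePQ_le_hodgeFiltration (show (p - r) + (q - r) = b by omega) (by omega)
        ((isOfHodgeType_iff_mem_hodgePQ hW A _).1
          (isOfHodgeType_complexGysin_of_add_eq hX hW g hr hab (by omega) (by omega)
            ((isOfHodgeType_iff_mem_hodgePQ hX B x₀).2 hz)))
    · rw [complexGysin_eq_zero_of_isOfHodgeType_of_lt hX hW g hr hab (Or.inr (not_le.1 hq))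
        ((isOfHodgeType_iff_mem_hodgePQ hX B x₀).2 hz), map_zero]
      exact Submodule.zero_mem _
  obtain ⟨x', hx', hxx'⟩ := hle hx
  obtain rfl : x' = x := B.pullback_injective a hxx'
  exact hx'

/-- **`g_*` of an admissible subspace of `(Hᵃ(X), F^{c+r})` is an admissible subspace of `(Hᵇ(W), Fᶜ)`**
(`a = b + 2r`, `dim X = dim W + r`; rationally spanned, sub-Hodge, in the filtration: the three lemmas
above). [cite: VoisinHodgeI2002, §7.3.1 (7.5) and §7.3.2] [cite: GrothendieckTopology1969, p. 300]
[cite: Voisin2025, §2.3] -/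
theorem HodgeModel.complexGysin_map_mem_ratSubHodgeInFilt (B : HodgeModel n X) (A : HodgeModel m W)
    (hX : IsSmoothProjective n X) (hW : IsSmoothProjective m W) (g : X ⟶ W) {r : ℕ} (hr : m + r = n)
    {a b : ℕ} (hab : a + 2 * m = b + 2 * n) {c : ℕ} {W' : Submodule ℂ (complexBetti X a)}
    (hW' : W' ∈ B.ratSubHodgeInFilt a (c + r)) :
    W'.map (complexGysin complexOrientationFamily hX hW g hab) ∈ A.ratSubHodgeInFilt b c :=
  ⟨hW'.1.map_complexGysin hX hW g hab, hW'.2.1.map_complexGysin B A hX hW g hr hab,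
    (Submodule.map_mono hW'.2.2).trans (B.map_complexGysin_hodgeFiltrationBetti_le A hX hW g hr hab c)⟩

/-! ### §3 The largest admissible subspaces under `g^*`, `Lʳ_η`, `g_*` (any `g`) -/

/-- **`g^*(max_W(i, c)) ≤ max_X(i, c)`**: the pull-back of the largest rational sub-Hodge structure of
`Hⁱ(W(ℂ); ℂ)` in `Fᶜ` lies in that of `Hⁱ(X(ℂ); ℂ)` (`g^*` of an admissible subspace is admissible,
`HodgeModel.map_mem_ratSubHodgeInFilt`; any morphism `g`). [cite: VoisinHodgeI2002, §7.3.2 and §7.3.1]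
[cite: GrothendieckTopology1969, p. 300] -/
theorem HodgeModel.map_complexBetti_map_maxRatSubHodgeInFilt_le (A : HodgeModel m W) (B : HodgeModel n X)
    (hW : IsSmoothProjective m W) (hX : IsSmoothProjective n X) (g : X ⟶ W) (i c : ℕ) :
    (A.maxRatSubHodgeInFilt i c).map (complexBetti.map g i).hom ≤ B.maxRatSubHodgeInFilt i c :=
  B.le_maxRatSubHodgeInFilt (A.map_mem_ratSubHodgeInFilt B hW hX g (A.maxRatSubHodgeInFilt_mem i c))

/-- **`Lʳ_η(max_X(i, c)) ≤ max_X(i + 2r, c + r)`** for the rational Kähler class `η = D.Hη` of a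
Kähler–rational datum (`Lʳ_η` of an admissible subspace is admissible, bidegree `(r, r)`:
`KaehlerRationalDatum.map_lefschetzPow_mem_ratSubHodgeInFilt`). [cite: VoisinHodgeI2002, §6.2.3 Rem. 6.27 and §7.3.1] -/
theorem KaehlerRationalDatum.map_lefschetzPow_maxRatSubHodgeInFilt_le (D : KaehlerRationalDatum n X)
    (B : HodgeModel n X) (hX : IsSmoothProjective n X) (i c r : ℕ) :
    (B.maxRatSubHodgeInFilt i c).map (lefschetzPow D.Hη r i) ≤
      B.maxRatSubHodgeInFilt (i + 2 * r) (c + r) :=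
  B.le_maxRatSubHodgeInFilt
    (D.map_lefschetzPow_mem_ratSubHodgeInFilt B hX (B.maxRatSubHodgeInFilt_mem i c) r)

/-- **`g_*(max_X(a, c + r)) ≤ max_W(b, c)`** (`a = b + 2r`, `dim X = dim W + r`): the Gysin image of the
largest rational sub-Hodge structure of `Hᵃ(X(ℂ); ℂ)` in `F^{c+r}` lies in the largest rational sub-Hodge
structure of `Hᵇ(W(ℂ); ℂ)` in `Fᶜ` (§2; any morphism `g`). [cite: VoisinHodgeI2002, §7.3.2 and §7.3.1 (7.5)]
[cite: GrothendieckTopology1969, p. 300] [cite: Voisin2025, §2.3] -/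
theorem HodgeModel.map_complexGysin_maxRatSubHodgeInFilt_le (B : HodgeModel n X) (A : HodgeModel m W)
    (hX : IsSmoothProjective n X) (hW : IsSmoothProjective m W) (g : X ⟶ W) {r : ℕ} (hr : m + r = n)
    {a b : ℕ} (hab : a + 2 * m = b + 2 * n) (c : ℕ) :
    (B.maxRatSubHodgeInFilt a (c + r)).map (complexGysin complexOrientationFamily hX hW g hab) ≤
      A.maxRatSubHodgeInFilt b c :=
  A.le_maxRatSubHodgeInFilt
    (B.complexGysin_map_mem_ratSubHodgeInFilt A hX hW g hr hab (B.maxRatSubHodgeInFilt_mem a (c + r)))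

/-- **`(g_* ∘ Lʳ_η)(max_X(i, c)) ≤ max_W(i, c)`**: the bidegree-`(0, 0)` composite `g_* ∘ Lʳ_η : Hⁱ(X) → Hⁱ(W)`
maps the largest rational sub-Hodge structure in `Fᶜ Hⁱ(X)` into that of `W` (any `g`, `dim X = dim W + r`).
[cite: VoisinHodgeI2002, §7.3.2 and §6.2.3 Rem. 6.27] [cite: GrothendieckTopology1969, p. 300] -/
theorem HodgeModel.map_complexGysin_lefschetzPow_maxRatSubHodgeInFilt_le (B : HodgeModel n X)
    (A : HodgeModel m W) (D : KaehlerRationalDatum n X) (hX : IsSmoothProjective n X)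
    (hW : IsSmoothProjective m W) (g : X ⟶ W) {r : ℕ} (hr : m + r = n) (i c : ℕ) :
    (B.maxRatSubHodgeInFilt i c).map
        (complexGysin complexOrientationFamily hX hW g (show (i + 2 * r) + 2 * m = i + 2 * n by omega) ∘ₗ
          lefschetzPow D.Hη r i) ≤ A.maxRatSubHodgeInFilt i c := by
  rw [Submodule.map_comp]
  exact (Submodule.map_mono (D.map_lefschetzPow_maxRatSubHodgeInFilt_le B hX i c r)).trans
    (B.map_complexGysin_maxRatSubHodgeInFilt_le A hX hW g hr _ c)

/-! ### §4 Along a surjection `X ↠ W`: equalities -/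

section Surjective

/-- **`(g_* ∘ Lʳ_η)(max_X(i, c)) = max_W(i, c)` along a surjection** `g : X ↠ W` of relative dimension `r`:
`≤` is §3; for `x ∈ max_W(i, c)`, `g^* x ∈ max_X(i, c)` and `x = (g_* ∘ Lʳ_η)(c₀⁻¹ g^* x)`
(`g_*(Lʳ_η(g^* x)) = c₀ • x`, `c₀ ≠ 0`: `KaehlerRationalDatum.exists_complexGysin_lefschetzPow_map_eq_smul_of_surjective`).
[cite: VoisinHodgeI2002, §7.3.2 Lemma 7.28 and Remark 7.29] [cite: GrothendieckTopology1969, p. 300] -/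
theorem HodgeModel.map_complexGysin_lefschetzPow_maxRatSubHodgeInFilt_eq (B : HodgeModel n X)
    (A : HodgeModel m W) (D : KaehlerRationalDatum n X) (hX : IsSmoothProjective n X)
    (hW : IsSmoothProjective m W) (g : X ⟶ W) [Surjective g.left] {r : ℕ} (hr : m + r = n) (i c : ℕ) :
    (B.maxRatSubHodgeInFilt i c).map
        (complexGysin complexOrientationFamily hX hW g (show (i + 2 * r) + 2 * m = i + 2 * n by omega) ∘ₗ
          lefschetzPow D.Hη r i) = A.maxRatSubHodgeInFilt i c := by
  refine le_antisymm (B.map_complexGysin_lefschetzPow_maxRatSubHodgeInFilt_le A D hX hW g hr i c)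
    fun x hx ↦ ?_
  obtain ⟨c₀, hc₀, hc⟩ := D.exists_complexGysin_lefschetzPow_map_eq_smul_of_surjective hX hW g hr
  refine ⟨c₀⁻¹ • complexBetti.map g i x, Submodule.smul_mem _ _ ?_, ?_⟩
  · exact A.map_complexBetti_map_maxRatSubHodgeInFilt_le B hW hX g i c (Submodule.mem_map_of_mem hx)
  · simp only [LinearMap.comp_apply, map_smul, hc, smul_smul, inv_mul_cancel₀ hc₀, one_smul]

/-- **THE LARGEST RATIONAL SUB-HODGE STRUCTURE IN `Fᶜ Hⁱ(W)` IS THE GYSIN IMAGE OF THE ONE IN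
`F^{c+r} H^{i+2r}(X)`** along a surjection `g : X ↠ W` of relative dimension `r`:
`g_*(max_X(i + 2r, c + r)) = max_W(i, c)` (`≤`: §3; `≥`: `max_W = (g_* ∘ Lʳ_η)(max_X(i, c))` and
`Lʳ_η(max_X(i, c)) ≤ max_X(i + 2r, c + r)`). [cite: VoisinHodgeI2002, §7.3.2 Lemma 7.28, Remark 7.29 and Lemma 7.30]
[cite: GrothendieckTopology1969, p. 300] [cite: Voisin2025, §2.3] -/
theorem HodgeModel.map_complexGysin_maxRatSubHodgeInFilt_eq (B : HodgeModel n X) (A : HodgeModel m W)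
    (hX : IsSmoothProjective n X) (hW : IsSmoothProjective m W) (g : X ⟶ W) [Surjective g.left]
    {r : ℕ} (hr : m + r = n) (i c : ℕ) :
    (B.maxRatSubHodgeInFilt (i + 2 * r) (c + r)).map
        (complexGysin complexOrientationFamily hX hW g (show (i + 2 * r) + 2 * m = i + 2 * n by omega)) =
      A.maxRatSubHodgeInFilt i c := by
  obtain ⟨D⟩ := nonempty_kaehlerRationalDatum hX
  refine le_antisymm (B.map_complexGysin_maxRatSubHodgeInFilt_le A hX hW g hr _ c) ?_
  rw [← B.map_complexGysin_lefschetzPow_maxRatSubHodgeInFilt_eq A D hX hW g hr i c, Submodule.map_comp]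
  exact Submodule.map_mono (D.map_lefschetzPow_maxRatSubHodgeInFilt_le B hX i c r)

/-- **`(g^*)⁻¹(max_X(i, c)) = max_W(i, c)` along a surjection**: a class `x ∈ Hⁱ(W(ℂ); ℂ)` lies in the
largest rational sub-Hodge structure in `Fᶜ Hⁱ(W)` iff `g^* x` lies in that of `X` (`⊇`: §3; `⊆`:
`x = c₀⁻¹ (g_* ∘ Lʳ_η)(g^* x)` and `(g_* ∘ Lʳ_η)(max_X(i, c)) = max_W(i, c)`).
[cite: VoisinHodgeI2002, §7.3.2 Lemma 7.28 and Remark 7.29] [cite: GrothendieckTopology1969, p. 300] -/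
theorem HodgeModel.comap_complexBetti_map_maxRatSubHodgeInFilt_eq (A : HodgeModel m W)
    (B : HodgeModel n X) (hW : IsSmoothProjective m W) (hX : IsSmoothProjective n X) (g : X ⟶ W)
    [Surjective g.left] (i c : ℕ) :
    (B.maxRatSubHodgeInFilt i c).comap (complexBetti.map g i).hom = A.maxRatSubHodgeInFilt i c := by
  refine le_antisymm (fun x hx ↦ ?_) (Submodule.map_le_iff_le_comap.1
    (A.map_complexBetti_map_maxRatSubHodgeInFilt_le B hW hX g i c))
  obtain ⟨r, hr⟩ : ∃ r, m + r = n := ⟨n - m, by have := dim_le_of_surjective hX hW g; omega⟩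
  obtain ⟨D⟩ := nonempty_kaehlerRationalDatum hX
  obtain ⟨c₀, hc₀, hc⟩ := D.exists_complexGysin_lefschetzPow_map_eq_smul_of_surjective hX hW g hr
  have hx' : complexGysin complexOrientationFamily hX hW g
      (show (i + 2 * r) + 2 * m = i + 2 * n by omega)
        (lefschetzPow D.Hη r i (complexBetti.map g i x)) ∈ A.maxRatSubHodgeInFilt i c := by
    rw [← B.map_complexGysin_lefschetzPow_maxRatSubHodgeInFilt_eq A D hX hW g hr i c]
    exact ⟨complexBetti.map g i x, hx, rfl⟩
  rw [hc i x] at hx'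
  simpa only [inv_smul_smul₀ hc₀] using (A.maxRatSubHodgeInFilt i c).smul_mem c₀⁻¹ hx'

/-- **The algebraic parts attached to the intermediate Jacobians** (`HodgeModel.algebraicPart`: for
`r' + k = i` the largest rational sub-Hodge structure in `F^{r'} Hⁱ`; Voisin II §8.2.1) **correspond under
`g_*` along a surjection**: `g_*(algebraicPart_X(i + 2r, k + r)) = algebraicPart_W(i, k)` for `k ≤ i`.
[cite: VoisinHodgeII2003, §8.2.1 (before Thm. 8.15)] [cite: VoisinHodgeI2002, §7.3.2 and §12.2.2] -/
theorem HodgeModel.map_complexGysin_algebraicPart_eq (B : HodgeModel n X) (A : HodgeModel m W)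
    (hX : IsSmoothProjective n X) (hW : IsSmoothProjective m W) (g : X ⟶ W) [Surjective g.left]
    {r : ℕ} (hr : m + r = n) {i k : ℕ} (hk : k ≤ i) :
    (B.algebraicPart (i + 2 * r) (k + r)).map
        (complexGysin complexOrientationFamily hX hW g (show (i + 2 * r) + 2 * m = i + 2 * n by omega)) =
      A.algebraicPart i k := by
  rw [B.algebraicPart_eq (show (i - k + r) + (k + r) = i + 2 * r by omega),
    A.algebraicPart_eq (show (i - k) + k = i by omega)]
  exact B.map_complexGysin_maxRatSubHodgeInFilt_eq A hX hW g hr i (i - k)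

/-- **`GHC(W, i, c) ↔ g_*(max_X(i + 2r, c + r)) ≤ Nᶜ Hⁱ(W(ℂ); ℂ)`** along a surjection `g : X ↠ W` of
relative dimension `r` (Grothendieck's amended general Hodge conjecture for `(W, i, c)` read on the Gysin
image of the largest rational sub-Hodge structure in `F^{c+r} H^{i+2r}(X)`; one Hodge model each).
[cite: GrothendieckTopology1969, p. 300] [cite: Arapura2006, §4 Lemma 4.2 (clause GHC)]
[cite: VoisinHodgeI2002, §7.3.2 and §11.3 Conj. 11.37] -/
theorem generalHodgePropertyFor_iff_map_complexGysin_le_of_surjective (B : HodgeModel n X)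
    (A : HodgeModel m W) (hX : IsSmoothProjective n X) (hW : IsSmoothProjective m W) (g : X ⟶ W)
    [Surjective g.left] {r : ℕ} (hr : m + r = n) (i c : ℕ) :
    GeneralHodgePropertyFor m W i c ↔
      (B.maxRatSubHodgeInFilt (i + 2 * r) (c + r)).map
          (complexGysin complexOrientationFamily hX hW g (show (i + 2 * r) + 2 * m = i + 2 * n by omega)) ≤
        supportedClasses W i c := by
  rw [generalHodgePropertyFor_iff_of_hodgeModel A hW, B.map_complexGysin_maxRatSubHodgeInFilt_eq A hX hW g hr]

end Surjective

end Literature.AlgebraicGeometry.HodgeTheory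

end
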